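import Summits.RiemannHypothesis.RiemannHypothesis.Theorems.SoninBandEnergyFourier
import Summits.RiemannHypothesis.RiemannHypothesis.Theorems.SoninBandEnergyCert
import HarnessLib

/-!
# Band energy of time-limited functions, V: enclosure of the matrix entries from the certificate

Cell `rh-explicit`, seat cc-s2-3 (`HOME/cc-s2-3/CERT-PLAN.md` §7, sub-task E1).  For rational coefficient lists
`l_j, l_k` write `P̂_l(ξ) = ∫_{[−1,1]} e^{−2πixξ} l(x) dx` and `M_jk = ∫_{[−1,1]} conj(P̂_j(ξ)) P̂_k(ξ) dξ`.  This
proof-only file links the analysis of files II–III to the kernel-checked data of file IV (`SoninBandEnergyCert`):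

* `momF_eq_momQ` — the fast moments of file IV are the moments `∫_{−1}^{1} x^k l`;
* `taylorSum_eq_ce_so` — the Taylor main term `Σ_{k<2m} ((−2πiξ)^k/k!) ∫x^k l` is `ce_l(y²) − i y so_l(y²)`, `y = πξ`
  (compressed even/odd lists of file IV), hence `‖P̂_l(ξ) − (ce_l(y²) − i y so_l(y²))‖ ≤ ρ_l` on `[−1,1]`
  (`norm_polyHat_sub_main_le`, from file II's Taylor step);
* `conj_main_mul_main` — `conj(ce_j − iy so_j)(ce_k − iy so_k) = ru_jk(y²) + i y J_jk(y²)`, and the `ξ`-integrals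
  `∫_{−1}^{1} ru(π²ξ²) dξ = (yT2 ru)(π²)`, `∫_{−1}^{1} πξ J(π²ξ²) dξ = 0` (odd integrand);
* `norm_entry_sub_le` — `‖M_jk − (yT2 ru_jk)(π²)‖ ≤ 2 δ_jk` with the rational slack `deltaQ` of file IV;
* `norm_entry_sub_mid_le_of_entryOK` — if the kernel test `entryOK U l_j l_k … mid` of file IV passed and `U ∋ π²/16`,
  then `‖M_jk − mid‖ ≤ radQ = 10⁻¹²`; `norm_entry_swap` — `‖M_kj − mid‖ = ‖M_jk − mid‖` (Hermitian symmetry);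
* `setIntegral_norm_sq_polyHat_eq_re` — `∫_{[−1,1]} ‖P̂_l‖² = Re M_ll`.

No definitions, no facts, no axioms.
-/

set_option linter.dupNamespace false  -- the mandated namespace repeats `RiemannHypothesis`

noncomputable section

open MeasureTheory Complex Set Finset
open scoped Real ComplexConjugate
open Summit.RiemannHypothesis.RiemannHypothesis.Theorems.SemilocalPolyWitness
open Literature.Analysis.ValidatedNumerics.NumericsMP

namespace Summit.RiemannHypothesis.RiemannHypothesis.BandEnergy

/-! ## The partial Fourier transform `P̂_l` of a list polynomial -/

/-- `x ↦ l(x)` (read in `ℂ`) is continuous. [folklore] -/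
theorem continuous_ev_complex (l : List ℚ) : Continuous fun x : ℝ => (LQ.ev l x : ℂ) :=
  Complex.continuous_ofReal.comp (LQ.continuous_ev l)

/-- `l` is integrable on `[−1,1]`. [folklore] -/
theorem integrableOn_ev_complex (l : List ℚ) : IntegrableOn (fun x : ℝ => (LQ.ev l x : ℂ)) (Icc (-1 : ℝ) 1) :=
  (continuous_ev_complex l).integrableOn_Icc

/-- `ξ ↦ P̂_l(ξ)` is continuous. [folklore] -/
theorem continuous_polyHat (l : List ℚ) :
    Continuous fun ξ : ℝ => ∫ x in Icc (-1 : ℝ) 1, cexp (↑(-2 * π * x * ξ) * I) * (LQ.ev l x : ℂ) :=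
  continuous_setIntegral_fourierKernel (integrableOn_ev_complex l)

/-- `‖P̂_l(ξ)‖ ≤ I_l = 2·absBound l 1`. [folklore] -/
theorem norm_polyHat_le (l : List ℚ) (ξ : ℝ) :
    ‖∫ x in Icc (-1 : ℝ) 1, cexp (↑(-2 * π * x * ξ) * I) * (LQ.ev l x : ℂ)‖ ≤ 2 * (LQ.absBound l 1 : ℝ) := by
  refine (norm_integral_le_integral_norm _).trans ?_
  have h : ∀ x : ℝ, ‖cexp (↑(-2 * π * x * ξ) * I) * (LQ.ev l x : ℂ)‖ = ‖(LQ.ev l x : ℂ)‖ := fun x => by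
    rw [norm_mul, Complex.norm_exp_ofReal_mul_I, one_mul]
  simp_rw [h]
  exact setIntegral_norm_ev_le l

/-- `π ≤ 3.1416`, hence `2 (2π)^n / n! ≤ 2 (2·3.1416)^n / n!`. [folklore] -/
theorem taylorConst_le (n : ℕ) :
    2 * (2 * π) ^ n / (n.factorial : ℝ) ≤ ((2 * (2 * (31416 / 10000 : ℚ)) ^ n / n.factorial : ℚ) : ℝ) := by
  have hπ : π ≤ 31416 / 10000 := by
    have := Real.pi_lt_d4; norm_num at this ⊢; linarith
  push_cast
  gcongr

/-! ## Fast moments and the compressed Taylor main term -/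

/-- `momF l k = ∫_{−1}^{1} x^k l(x) dx`. [folklore] -/
theorem momF_eq_integral : ∀ (l : List ℚ) (k : ℕ),
    ((momF l k : ℚ) : ℝ) = ∫ x in (-1 : ℝ)..1, x ^ k * LQ.ev l x
  | [], k => by simp [momF]
  | a :: as, k => by
      have ih := momF_eq_integral as (k + 1)
      have h1 : (fun x : ℝ => x ^ k * LQ.ev (a :: as) x)
          = fun x : ℝ => (a : ℝ) * x ^ k + x ^ (k + 1) * LQ.ev as x := by
        funext x; rw [LQ.ev_cons]; ring
      have i1 : IntervalIntegrable (fun x : ℝ => (a : ℝ) * x ^ k) volume (-1 : ℝ) 1 :=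
        (continuous_const.mul (continuous_pow k)).intervalIntegrable _ _
      have i2 : IntervalIntegrable (fun x : ℝ => x ^ (k + 1) * LQ.ev as x) volume (-1 : ℝ) 1 :=
        ((continuous_pow (k + 1)).mul (LQ.continuous_ev as)).intervalIntegrable _ _
      rw [h1, intervalIntegral.integral_add i1 i2, ← ih, intervalIntegral.integral_const_mul, integral_pow, momF]
      push_cast
      ring

/-- The fast moments agree with `momQ`. [folklore] -/
theorem momF_eq_momQ (l : List ℚ) (k : ℕ) : momF l k = momQ l k := by
  have h : ((momF l k : ℚ) : ℝ) = ((momQ l k : ℚ) : ℝ) := by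
    rw [momF_eq_integral, intervalIntegral_pow_mul_ev]
  exact_mod_cast h

/-- `ev (p ++ [c]) x = ev p x + c·x^{|p|}`. [folklore] -/
theorem ev_append_singleton : ∀ (p : List ℚ) (c : ℚ) (x : ℝ),
    LQ.ev (p ++ [c]) x = LQ.ev p x + (c : ℝ) * x ^ p.length
  | [], c, x => by simp
  | a :: as, c, x => by
      rw [List.cons_append, LQ.ev_cons, LQ.ev_cons, ev_append_singleton as c x, List.length_cons, pow_succ]
      ring

/-- `ceList l (m+1) = ceList l m ++ [ce_m]`. [folklore] -/
theorem ceList_succ (l : List ℚ) (m : ℕ) :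
    ceList l (m + 1) = ceList l m ++ [(-1) ^ m * 2 ^ (2 * m) * momF l (2 * m) / (2 * m).factorial] := by
  simp [ceList, List.range_succ]

/-- `soList l (m+1) = soList l m ++ [so_m]`. [folklore] -/
theorem soList_succ (l : List ℚ) (m : ℕ) :
    soList l (m + 1) = soList l m ++ [(-1) ^ m * 2 ^ (2 * m + 1) * momF l (2 * m + 1) / (2 * m + 1).factorial] := by
  simp [soList, List.range_succ]

/-- Lengths of the compressed lists. [folklore] -/
@[simp] theorem length_ceList (l : List ℚ) (m : ℕ) : (ceList l m).length = m := by simp [ceList]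

/-- Lengths of the compressed lists. [folklore] -/
@[simp] theorem length_soList (l : List ℚ) (m : ℕ) : (soList l m).length = m := by simp [soList]

/-- **The Taylor main term, compressed**: `Σ_{k<2m} ((−2πiξ)^k/k!) momQ l k = ce_l(y²) − i·y·so_l(y²)`, `y = πξ`.
[folklore] -/
theorem taylorSum_eq_ce_so (l : List ℚ) (ξ : ℝ) : ∀ m : ℕ,
    ∑ k ∈ range (2 * m), (↑(-2 * π * ξ) * I) ^ k / (k.factorial : ℂ) * ((momQ l k : ℝ) : ℂ)
      = (LQ.ev (ceList l m) ((π * ξ) ^ 2) : ℂ) - I * ((π * ξ : ℝ) : ℂ) * (LQ.ev (soList l m) ((π * ξ) ^ 2) : ℂ)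
  | 0 => by simp [ceList, soList]
  | m + 1 => by
      have hw : ∀ k : ℕ, ((↑(-2 * π * ξ) * I : ℂ)) ^ k = (-2 * ((π * ξ : ℝ) : ℂ) * I) ^ k := fun k => by
        push_cast; ring
      rw [show 2 * (m + 1) = 2 * m + 1 + 1 by ring, Finset.sum_range_succ, Finset.sum_range_succ,
        taylorSum_eq_ce_so l ξ m, ceList_succ, soList_succ, ev_append_singleton, ev_append_singleton,
        length_ceList, length_soList, hw, hw, neg_two_mul_I_pow_even, neg_two_mul_I_pow_odd,
        ← momF_eq_momQ, ← momF_eq_momQ]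
      push_cast
      rw [← pow_mul]
      ring

/-- **Taylor remainder for `P̂_l`, compressed form**: for `12 ≤ 2m` and `|ξ| ≤ 1`,
`‖P̂_l(ξ) − (ce_l(y²) − i y so_l(y²))‖ ≤ ρ_l := 2 (2·3.1416)^{2m}/(2m)! · 2·absBound l 1`, `y = πξ`. [folklore] -/
theorem norm_polyHat_sub_main_le (l : List ℚ) {m : ℕ} (hm : 12 ≤ 2 * m) {ξ : ℝ} (hξ : |ξ| ≤ 1) :
    ‖(∫ x in Icc (-1 : ℝ) 1, cexp (↑(-2 * π * x * ξ) * I) * (LQ.ev l x : ℂ))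
        - ((LQ.ev (ceList l m) ((π * ξ) ^ 2) : ℂ) - I * ((π * ξ : ℝ) : ℂ) * (LQ.ev (soList l m) ((π * ξ) ^ 2) : ℂ))‖
      ≤ ((2 * (2 * (31416 / 10000 : ℚ)) ^ (2 * m) / (2 * m).factorial * (2 * LQ.absBound l 1) : ℚ) : ℝ) := by
  have ht := norm_setIntegral_fourierKernel_sub_taylor_le (integrableOn_ev_complex l) hξ hm
  have hmq : ∀ k : ℕ, (↑(-2 * π * ξ) * I) ^ k / (k.factorial : ℂ)
      * ∫ x in Icc (-1 : ℝ) 1, (x : ℂ) ^ k * (LQ.ev l x : ℂ)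
      = (↑(-2 * π * ξ) * I) ^ k / (k.factorial : ℂ) * ((momQ l k : ℝ) : ℂ) := fun k => by
    rw [setIntegral_pow_mul_ev_complex]
  simp_rw [hmq, taylorSum_eq_ce_so] at ht
  refine ht.trans ?_
  have h1 := taylorConst_le (2 * m)
  have h2 := setIntegral_norm_ev_le l
  have h3 : (0 : ℝ) ≤ ∫ x in Icc (-1 : ℝ) 1, ‖(LQ.ev l x : ℂ)‖ := integral_nonneg fun _ => norm_nonneg _
  have h4 : (0 : ℝ) ≤ ((2 * (2 * (31416 / 10000 : ℚ)) ^ (2 * m) / (2 * m).factorial : ℚ) : ℝ) := by positivity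
  push_cast at h1 h4 ⊢
  calc 2 * (2 * π) ^ (2 * m) / ((2 * m).factorial : ℝ) * ∫ x in Icc (-1 : ℝ) 1, ‖(LQ.ev l x : ℂ)‖
      ≤ (2 * (2 * (31416 / 10000 : ℝ)) ^ (2 * m) / (2 * m).factorial) * ∫ x in Icc (-1 : ℝ) 1, ‖(LQ.ev l x : ℂ)‖ :=
        mul_le_mul_of_nonneg_right h1 h3
    _ ≤ (2 * (2 * (31416 / 10000 : ℝ)) ^ (2 * m) / (2 * m).factorial) * (2 * (LQ.absBound l 1 : ℝ)) :=
        mul_le_mul_of_nonneg_left h2 h4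
    _ = _ := by ring

/-! ## Products of main terms and their `ξ`-integrals -/

/-- `conj(ce_j(u) − i y so_j(u)) · (ce_k(u) − i y so_k(u)) = ru_jk(u) + i y J_jk(u)` at `u = y²`, with
`ru = ce_j ce_k + u so_j so_k` (`ruList`) and `J = so_j ce_k − ce_j so_k`. [folklore] -/
theorem conj_main_mul_main (cej soj cek sok : List ℚ) (y : ℝ) :
    conj ((LQ.ev cej (y ^ 2) : ℂ) - I * (y : ℂ) * (LQ.ev soj (y ^ 2) : ℂ))
        * ((LQ.ev cek (y ^ 2) : ℂ) - I * (y : ℂ) * (LQ.ev sok (y ^ 2) : ℂ))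
      = (LQ.ev (ruList cej soj cek sok) (y ^ 2) : ℂ)
        + I * (y : ℂ) * (LQ.ev (LQ.add (LQ.mul soj cek) (LQ.neg (LQ.mul cej sok))) (y ^ 2) : ℂ) := by
  rw [ruList, LQ.ev_add, LQ.ev_mul, LQ.ev_cons, LQ.ev_mul, LQ.ev_add, LQ.ev_mul, LQ.ev_neg, LQ.ev_mul]
  simp only [map_sub, map_mul, Complex.conj_ofReal, Complex.conj_I]
  push_cast
  have hI2 : I ^ 2 = -1 := Complex.I_sq
  linear_combination (-(y : ℂ) ^ 2 * (LQ.ev soj (y ^ 2) : ℂ) * (LQ.ev sok (y ^ 2) : ℂ)) * hI2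

/-- Lengths of `yT2`. [folklore] -/
@[simp] theorem length_yT2 (R : List ℚ) : (yT2 R).length = R.length := by simp [yT2]

/-- **Termwise integration, even case**: `∫_{−1}^{1} R(π²ξ²) dξ = (yT2 R)(π²)`. [folklore] -/
theorem integral_ev_sq (R : List ℚ) : ∫ ξ in (-1 : ℝ)..1, LQ.ev R ((π * ξ) ^ 2) = LQ.ev (yT2 R) (π ^ 2) := by
  have e : (fun ξ : ℝ => LQ.ev R ((π * ξ) ^ 2))
      = fun ξ => ∑ i ∈ range R.length, (((R.getD i 0 : ℚ) : ℝ) * π ^ (2 * i)) * ξ ^ (2 * i) := by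
    funext ξ; rw [LQ.ev_eq_sum]
    exact Finset.sum_congr rfl fun i _ => by rw [← pow_mul, mul_pow, mul_comm 2 i]; ring
  rw [e, intervalIntegral.integral_finsetSum (fun i _ => by
      exact ((continuous_const).mul (continuous_pow _)).intervalIntegrable _ _)]
  simp_rw [intervalIntegral.integral_const_mul, integral_pow]
  rw [LQ.ev_eq_sum, length_yT2]
  refine Finset.sum_congr rfl fun i hi => ?_
  rw [yT2, getD_map_range _ (Finset.mem_range.1 hi)]
  have hodd : (-1 : ℝ) ^ (2 * i + 1) = -1 := by
    rw [pow_succ, pow_mul]; norm_num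
  rw [hodd, ← pow_mul]
  push_cast
  field_simp
  ring

/-- **Termwise integration, odd case**: `∫_{−1}^{1} (πξ) · J(π²ξ²) dξ = 0`. [folklore] -/
theorem integral_mul_ev_sq (J : List ℚ) : ∫ ξ in (-1 : ℝ)..1, (π * ξ) * LQ.ev J ((π * ξ) ^ 2) = 0 := by
  have e : (fun ξ : ℝ => (π * ξ) * LQ.ev J ((π * ξ) ^ 2))
      = fun ξ => ∑ i ∈ range J.length, (((J.getD i 0 : ℚ) : ℝ) * π ^ (2 * i + 1)) * ξ ^ (2 * i + 1) := by
    funext ξ; rw [LQ.ev_eq_sum, Finset.mul_sum]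
    exact Finset.sum_congr rfl fun i _ => by rw [← pow_mul, mul_pow, mul_comm 2 i]; ring
  rw [e, intervalIntegral.integral_finsetSum (fun i _ => by
      exact ((continuous_const).mul (continuous_pow _)).intervalIntegrable _ _)]
  simp_rw [intervalIntegral.integral_const_mul, integral_pow]
  refine Finset.sum_eq_zero fun i _ => ?_
  have hev : (-1 : ℝ) ^ (2 * i + 1 + 1) = 1 := by
    rw [show 2 * i + 1 + 1 = 2 * (i + 1) by ring, pow_mul]; norm_num
  rw [hev]; simp

/-- The complex `ξ`-integral of the product main term: `∫_{[−1,1]} (ru(π²ξ²) + i πξ J(π²ξ²)) dξ = (yT2 ru)(π²)`, and the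
integrand is integrable. [folklore] -/
theorem setIntegral_main_product (R J : List ℚ) :
    IntegrableOn (fun ξ : ℝ => (LQ.ev R ((π * ξ) ^ 2) : ℂ)
      + I * ((π * ξ : ℝ) : ℂ) * (LQ.ev J ((π * ξ) ^ 2) : ℂ)) (Icc (-1 : ℝ) 1) ∧
    ∫ ξ in Icc (-1 : ℝ) 1, ((LQ.ev R ((π * ξ) ^ 2) : ℂ) + I * ((π * ξ : ℝ) : ℂ) * (LQ.ev J ((π * ξ) ^ 2) : ℂ))
      = (LQ.ev (yT2 R) (π ^ 2) : ℂ) := by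
  have hcR : Continuous fun ξ : ℝ => (LQ.ev R ((π * ξ) ^ 2) : ℂ) :=
    Complex.continuous_ofReal.comp ((LQ.continuous_ev R).comp ((continuous_const.mul continuous_id).pow 2))
  have hcJ : Continuous fun ξ : ℝ => I * ((π * ξ : ℝ) : ℂ) * (LQ.ev J ((π * ξ) ^ 2) : ℂ) :=
    (continuous_const.mul (Complex.continuous_ofReal.comp (continuous_const.mul continuous_id))).mul
      (Complex.continuous_ofReal.comp ((LQ.continuous_ev J).comp ((continuous_const.mul continuous_id).pow 2)))
  refine ⟨(hcR.add hcJ).integrableOn_Icc, ?_⟩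
  rw [integral_add hcR.integrableOn_Icc hcJ.integrableOn_Icc]
  have h1 : ∫ ξ in Icc (-1 : ℝ) 1, (LQ.ev R ((π * ξ) ^ 2) : ℂ) = (LQ.ev (yT2 R) (π ^ 2) : ℂ) := by
    rw [integral_complex_ofReal, integral_Icc_eq_integral_Ioc,
      ← intervalIntegral.integral_of_le (by norm_num : (-1 : ℝ) ≤ 1), integral_ev_sq]
  have h2 : ∫ ξ in Icc (-1 : ℝ) 1, I * ((π * ξ : ℝ) : ℂ) * (LQ.ev J ((π * ξ) ^ 2) : ℂ) = 0 := by
    have e : (fun ξ : ℝ => I * ((π * ξ : ℝ) : ℂ) * (LQ.ev J ((π * ξ) ^ 2) : ℂ))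
        = fun ξ : ℝ => I * (((π * ξ) * LQ.ev J ((π * ξ) ^ 2) : ℝ) : ℂ) := by
      funext ξ; push_cast; ring
    rw [e, integral_const_mul, integral_complex_ofReal, integral_Icc_eq_integral_Ioc,
      ← intervalIntegral.integral_of_le (by norm_num : (-1 : ℝ) ≤ 1), integral_mul_ev_sq]
    simp
  rw [h1, h2, add_zero]

/-! ## The entry `M_jk = ∫ conj(P̂_j) P̂_k` and its enclosure -/

/-- `‖conj E_j · E_k − conj A_j · A_k‖ ≤ (I_j + ρ_j) ρ_k + ρ_j I_k` from `‖E‖ ≤ I`, `‖E − A‖ ≤ ρ`. [folklore] -/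
theorem norm_conj_mul_sub_conj_mul_le {Ej Ek Aj Ak : ℂ} {Ij Ik ρj ρk : ℝ} (hIj : ‖Ej‖ ≤ Ij) (hIk : ‖Ek‖ ≤ Ik)
    (hrj : ‖Ej - Aj‖ ≤ ρj) (hrk : ‖Ek - Ak‖ ≤ ρk) :
    ‖conj Ej * Ek - conj Aj * Ak‖ ≤ (Ij + ρj) * ρk + ρj * Ik := by
  have hsplit : conj Ej * Ek - conj Aj * Ak = conj Aj * (Ek - Ak) + conj (Ej - Aj) * Ek := by
    have h : conj (Ej - Aj) = conj Ej - conj Aj := map_sub _ _ _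
    rw [h]; ring
  rw [hsplit]
  have hAjn : ‖Aj‖ ≤ Ij + ρj := by
    have h1 := norm_sub_le Ej (Ej - Aj); rw [sub_sub_cancel] at h1; linarith
  have h0 : 0 ≤ Ij + ρj := (norm_nonneg _).trans hAjn
  have h0' : 0 ≤ ρj := (norm_nonneg _).trans hrj
  calc ‖conj Aj * (Ek - Ak) + conj (Ej - Aj) * Ek‖
      ≤ ‖conj Aj * (Ek - Ak)‖ + ‖conj (Ej - Aj) * Ek‖ := norm_add_le _ _
    _ = ‖Aj‖ * ‖Ek - Ak‖ + ‖Ej - Aj‖ * ‖Ek‖ := by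
        rw [norm_mul, norm_mul, Complex.norm_conj, Complex.norm_conj]
    _ ≤ (Ij + ρj) * ρk + ρj * Ik := by gcongr

/-- `ξ ↦ conj(P̂_j(ξ)) P̂_k(ξ)` is integrable on `[−1,1]`. [folklore] -/
theorem integrableOn_conj_polyHat_mul (lj lk : List ℚ) :
    IntegrableOn (fun ξ : ℝ => conj (∫ x in Icc (-1 : ℝ) 1, cexp (↑(-2 * π * x * ξ) * I) * (LQ.ev lj x : ℂ))
      * (∫ x in Icc (-1 : ℝ) 1, cexp (↑(-2 * π * x * ξ) * I) * (LQ.ev lk x : ℂ))) (Icc (-1 : ℝ) 1) :=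
  ((Complex.continuous_conj.comp (continuous_polyHat lj)).mul (continuous_polyHat lk)).integrableOn_Icc

/-- **Entry enclosure (norm form)**: `‖M_jk − (yT2 ru_jk)(π²)‖ ≤ 2 δ_jk` (`deltaQ` of file IV). [folklore] -/
theorem norm_entry_sub_le (lj lk : List ℚ) (hm : 12 ≤ 2 * mT) :
    ‖(∫ ξ in Icc (-1 : ℝ) 1, conj (∫ x in Icc (-1 : ℝ) 1, cexp (↑(-2 * π * x * ξ) * I) * (LQ.ev lj x : ℂ))
          * (∫ x in Icc (-1 : ℝ) 1, cexp (↑(-2 * π * x * ξ) * I) * (LQ.ev lk x : ℂ)))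
        - (LQ.ev (yT2 (ruList (ceList lj mT) (soList lj mT) (ceList lk mT) (soList lk mT))) (π ^ 2) : ℂ)‖
      ≤ 2 * ((deltaQ lj lk : ℚ) : ℝ) := by
  set J := LQ.add (LQ.mul (soList lj mT) (ceList lk mT)) (LQ.neg (LQ.mul (ceList lj mT) (soList lk mT))) with hJ
  obtain ⟨hiY, hY⟩ := setIntegral_main_product (ruList (ceList lj mT) (soList lj mT) (ceList lk mT) (soList lk mT)) J
  rw [← hY, ← integral_sub (integrableOn_conj_polyHat_mul lj lk) hiY]
  refine (norm_integral_le_integral_norm _).trans ?_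
  have hpt : ∀ ξ ∈ Icc (-1 : ℝ) 1,
      ‖conj (∫ x in Icc (-1 : ℝ) 1, cexp (↑(-2 * π * x * ξ) * I) * (LQ.ev lj x : ℂ))
          * (∫ x in Icc (-1 : ℝ) 1, cexp (↑(-2 * π * x * ξ) * I) * (LQ.ev lk x : ℂ))
        - ((LQ.ev (ruList (ceList lj mT) (soList lj mT) (ceList lk mT) (soList lk mT)) ((π * ξ) ^ 2) : ℂ)
            + I * ((π * ξ : ℝ) : ℂ) * (LQ.ev J ((π * ξ) ^ 2) : ℂ))‖ ≤ ((deltaQ lj lk : ℚ) : ℝ) := by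
    intro ξ hξ
    have hξ' : |ξ| ≤ 1 := abs_le.2 ⟨by linarith [hξ.1], hξ.2⟩
    rw [hJ, ← conj_main_mul_main]
    have h := norm_conj_mul_sub_conj_mul_le (norm_polyHat_le lj ξ) (norm_polyHat_le lk ξ)
      (norm_polyHat_sub_main_le lj hm hξ') (norm_polyHat_sub_main_le lk hm hξ')
    refine h.trans (le_of_eq ?_)
    rw [deltaQ]; push_cast; ring
  refine (setIntegral_mono_on ((integrableOn_conj_polyHat_mul lj lk).sub hiY).norm (by simp) measurableSet_Icc
    hpt).trans ?_
  rw [setIntegral_const, smul_eq_mul, Measure.real, Real.volume_Icc]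
  norm_num

/-- If `Y ∈ [lo/S, hi/S]` then `|Y − c| ≤ max(|lo − cS|, |hi − cS|)/S`. [folklore] -/
theorem abs_sub_le_of_mem_interval {Y c lo hi S : ℝ} (hS : 0 < S) (hlo : lo / S ≤ Y) (hhi : Y ≤ hi / S) :
    |Y - c| ≤ max |lo - c * S| |hi - c * S| / S := by
  rw [le_div_iff₀ hS, ← abs_of_pos hS, ← abs_mul, abs_of_pos hS, sub_mul]
  rw [div_le_iff₀ hS] at hlo
  rw [le_div_iff₀ hS] at hhi
  rcases le_total (Y * S) (c * S) with h | h
  · rw [abs_of_nonpos (by linarith)]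
    exact le_trans (by have := neg_abs_le (lo - c * S); linarith) (le_max_left _ _)
  · rw [abs_of_nonneg (by linarith)]
    exact le_trans (by have := le_abs_self (hi - c * S); linarith) (le_max_right _ _)

/-- Unfolding the Boolean entry test of file IV (stated with variables only, so that nothing is evaluated). [folklore] -/
theorem entryOK_iff (U : MI) (lj lk : List ℚ) (cj ck : List ℚ × List ℚ) (mid : ℚ) :
    entryOK U lj lk cj ck mid = true ↔
      2 * deltaQ lj lk * scaleS
        + max |((hornerMI scaleS (scaleList (yT2 (ruList cj.1 cj.2 ck.1 ck.2)) 16) U).lo : ℚ) - mid * scaleS|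
              |((hornerMI scaleS (scaleList (yT2 (ruList cj.1 cj.2 ck.1 ck.2)) 16) U).hi : ℚ) - mid * scaleS|
        ≤ radQ * scaleS := by
  unfold entryOK
  simp only [decide_eq_true_eq]

/-- `0 < S`. [folklore] -/
theorem scaleS_pos : 0 < scaleS := by unfold scaleS; norm_num

/-- **From the kernel test to the enclosure**: if `entryOK U l_j l_k (ce_j, so_j) (ce_k, so_k) mid = true` (file IV) and
`U ∋ π²/16` at scale `S`, then `‖M_jk − mid‖ ≤ radQ`. [folklore] -/
theorem norm_entry_sub_mid_le_of_entryOK (lj lk : List ℚ) (mid : ℚ) {U : MI}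
    (hU : MI.mem scaleS (π ^ 2 / 16) U) (hm : 12 ≤ 2 * mT)
    (h : entryOK U lj lk (ceList lj mT, soList lj mT) (ceList lk mT, soList lk mT) mid = true) :
    ‖(∫ ξ in Icc (-1 : ℝ) 1, conj (∫ x in Icc (-1 : ℝ) 1, cexp (↑(-2 * π * x * ξ) * I) * (LQ.ev lj x : ℂ))
          * (∫ x in Icc (-1 : ℝ) 1, cexp (↑(-2 * π * x * ξ) * I) * (LQ.ev lk x : ℂ))) - (mid : ℂ)‖
      ≤ ((radQ : ℚ) : ℝ) := by
  have hS : 0 < scaleS := scaleS_pos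
  have hSr : (0 : ℝ) < (scaleS : ℝ) := by exact_mod_cast hS
  rw [entryOK_iff] at h
  set Ru := ruList (ceList lj mT) (soList lj mT) (ceList lk mT) (soList lk mT) with hRu
  set R := hornerMI scaleS (scaleList (yT2 Ru) 16) U with hR
  -- the exact value `Y = (yT2 Ru)(π²)` lies in `[R.lo/S, R.hi/S]`
  have hY : LQ.ev (scaleList (yT2 Ru) 16) (π ^ 2 / 16) = LQ.ev (yT2 Ru) (π ^ 2) := by
    rw [ev_scaleList, show (((16 : ℚ) : ℝ)) * (π ^ 2 / 16) = π ^ 2 by push_cast; ring]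
  have hlo := lo_le_of_mem_hornerMI hS hU (scaleList (yT2 Ru) 16)
  have hhi := le_hi_of_mem_hornerMI hS hU (scaleList (yT2 Ru) 16)
  rw [hY, ← hR] at hlo hhi
  have hmid := abs_sub_le_of_mem_interval (c := ((mid : ℚ) : ℝ)) hSr hlo hhi
  have hent := norm_entry_sub_le lj lk hm
  rw [← hRu] at hent
  have hq : 2 * ((deltaQ lj lk : ℚ) : ℝ) * (scaleS : ℝ)
      + max |((R.lo : ℤ) : ℝ) - ((mid : ℚ) : ℝ) * (scaleS : ℝ)| |((R.hi : ℤ) : ℝ) - ((mid : ℚ) : ℝ) * (scaleS : ℝ)|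
      ≤ ((radQ : ℚ) : ℝ) * (scaleS : ℝ) := by
    have h' := h
    exact_mod_cast h'
  -- combine: ‖M − mid‖ ≤ ‖M − Y‖ + |Y − mid|
  have e : ((LQ.ev (yT2 Ru) (π ^ 2) : ℝ) : ℂ) - ((mid : ℚ) : ℂ)
      = ((LQ.ev (yT2 Ru) (π ^ 2) - ((mid : ℚ) : ℝ) : ℝ) : ℂ) := by push_cast; ring
  have hYmid : ‖((LQ.ev (yT2 Ru) (π ^ 2) : ℝ) : ℂ) - ((mid : ℚ) : ℂ)‖ = |LQ.ev (yT2 Ru) (π ^ 2) - ((mid : ℚ) : ℝ)| := by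
    rw [e, Complex.norm_real, Real.norm_eq_abs]
  have htri := norm_sub_le_norm_sub_add_norm_sub
    (∫ ξ in Icc (-1 : ℝ) 1, conj (∫ x in Icc (-1 : ℝ) 1, cexp (↑(-2 * π * x * ξ) * I) * (LQ.ev lj x : ℂ))
          * (∫ x in Icc (-1 : ℝ) 1, cexp (↑(-2 * π * x * ξ) * I) * (LQ.ev lk x : ℂ)))
    ((LQ.ev (yT2 Ru) (π ^ 2) : ℝ) : ℂ) ((mid : ℚ) : ℂ)
  rw [hYmid] at htri
  have hdiv : 2 * ((deltaQ lj lk : ℚ) : ℝ)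
      + max |((R.lo : ℤ) : ℝ) - ((mid : ℚ) : ℝ) * (scaleS : ℝ)| |((R.hi : ℤ) : ℝ) - ((mid : ℚ) : ℝ) * (scaleS : ℝ)|
        / (scaleS : ℝ) ≤ ((radQ : ℚ) : ℝ) := by
    rw [← le_sub_iff_add_le', div_le_iff₀ hSr]
    nlinarith
  linarith [hmid, hent, htri, hdiv]

/-- **Hermitian symmetry of the entries**: `M_kj = conj M_jk`, hence `‖M_kj − mid‖ = ‖M_jk − mid‖` for real `mid`.
[folklore] -/
theorem norm_entry_swap (lj lk : List ℚ) (mid : ℝ) :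
    ‖(∫ ξ in Icc (-1 : ℝ) 1, conj (∫ x in Icc (-1 : ℝ) 1, cexp (↑(-2 * π * x * ξ) * I) * (LQ.ev lk x : ℂ))
          * (∫ x in Icc (-1 : ℝ) 1, cexp (↑(-2 * π * x * ξ) * I) * (LQ.ev lj x : ℂ))) - (mid : ℂ)‖
      = ‖(∫ ξ in Icc (-1 : ℝ) 1, conj (∫ x in Icc (-1 : ℝ) 1, cexp (↑(-2 * π * x * ξ) * I) * (LQ.ev lj x : ℂ))
          * (∫ x in Icc (-1 : ℝ) 1, cexp (↑(-2 * π * x * ξ) * I) * (LQ.ev lk x : ℂ))) - (mid : ℂ)‖ := by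
  have h : (∫ ξ in Icc (-1 : ℝ) 1, conj (∫ x in Icc (-1 : ℝ) 1, cexp (↑(-2 * π * x * ξ) * I) * (LQ.ev lk x : ℂ))
        * (∫ x in Icc (-1 : ℝ) 1, cexp (↑(-2 * π * x * ξ) * I) * (LQ.ev lj x : ℂ)))
      = conj (∫ ξ in Icc (-1 : ℝ) 1, conj (∫ x in Icc (-1 : ℝ) 1, cexp (↑(-2 * π * x * ξ) * I) * (LQ.ev lj x : ℂ))
        * (∫ x in Icc (-1 : ℝ) 1, cexp (↑(-2 * π * x * ξ) * I) * (LQ.ev lk x : ℂ))) := by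
    rw [← integral_conj]
    refine integral_congr_ae (Filter.Eventually.of_forall fun ξ => ?_)
    simp only [map_mul, Complex.conj_conj]
    ring
  rw [h]
  set X := (∫ ξ in Icc (-1 : ℝ) 1, conj (∫ x in Icc (-1 : ℝ) 1, cexp (↑(-2 * π * x * ξ) * I) * (LQ.ev lj x : ℂ))
        * (∫ x in Icc (-1 : ℝ) 1, cexp (↑(-2 * π * x * ξ) * I) * (LQ.ev lk x : ℂ))) with hX
  have e : conj X - (mid : ℂ) = conj (X - (mid : ℂ)) := by rw [map_sub, Complex.conj_ofReal]
  rw [e, Complex.norm_conj]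

/-- `∫_{[−1,1]} ‖P̂_l(ξ)‖² dξ = Re M_ll`. [folklore] -/
theorem setIntegral_norm_sq_polyHat_eq_re (l : List ℚ) :
    ∫ ξ in Icc (-1 : ℝ) 1, ‖∫ x in Icc (-1 : ℝ) 1, cexp (↑(-2 * π * x * ξ) * I) * (LQ.ev l x : ℂ)‖ ^ 2
      = (∫ ξ in Icc (-1 : ℝ) 1, conj (∫ x in Icc (-1 : ℝ) 1, cexp (↑(-2 * π * x * ξ) * I) * (LQ.ev l x : ℂ))
          * (∫ x in Icc (-1 : ℝ) 1, cexp (↑(-2 * π * x * ξ) * I) * (LQ.ev l x : ℂ))).re := by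
  have h : ∀ z : ℂ, conj z * z = ((‖z‖ ^ 2 : ℝ) : ℂ) := fun z => by rw [Complex.conj_mul', Complex.ofReal_pow]
  simp_rw [h]
  rw [integral_complex_ofReal, Complex.ofReal_re]

end Summit.RiemannHypothesis.RiemannHypothesis.BandEnergy
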